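import Literature.AnabelianGeometry.SemiGraphs.AmbientVocabOfReal
import Literature.AnabelianGeometry.SemiGraphs.Localizations

/-!
# [SemiAnbd] Rmk 4.1.1 at the real vocabulary: compatible arrows preserve `𝔾`-open and `𝔾`-closed edges

Mochizuki, *Semi-graphs of anabelioids*, Publ. RIMS **42** (2006), §4 Rmk 4.1.1 p.51: "One verifies
immediately that any locally finite étale morphism compatible with given local `(𝔾, Γ)`-structures
maps `𝔾`-open (respectively, `𝔾`-closed) edges to `𝔾`-open (respectively, `𝔾`-closed) edges." (kurims
`paper:url-f33ace170ff4`, read on p.51).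
[cite: MochizukiSemiAnbd2006, Rmk 4.1.1, p. 51]

PROOF-ONLY — the first §4 statement DISCHARGED AT THE REAL VOCABULARY: `Localizations.lean` types the
claim as the container-level predicate `Loc.GOpenClosedPreservedStatement 𝓥 G Γ`, not provable at an
abstract `𝓥 : SemiAnbdVocab Obj` (it needs two facts about the real objects that are not container
laws); at `𝓥 := SemiAnbdVocab.ofReal R` (`AmbientVocabOfReal.lean`) both facts hold and the statement is
a theorem, `Loc.gOpenClosedPreservedStatement_ofReal`:

* `SemiAnbdVocab.ofReal_mapE_locMapE_centerE` — the induced `H[e] → H'[e']` (Def 4.1 (iv)) maps the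
  distinguished edge of `H[e]` to that of `H'[e']` (t1's `𝔾[e]` has exactly one edge);
* `SemiAnbdVocab.ofReal_isClosedEdge_mapE` / `…_iff_of_iso`, `ofReal_isOpenEdge_mapE_iff_of_iso` — every
  arrow of `SgA` maps closed edges to closed edges (branch bijections + compatibility with the
  coincidence maps), hence isomorphisms preserve and reflect closed / open edges;
* the `Γ`-orbit bookkeeping of Def 4.1 (iii): two structure morphisms of one `(𝔾, Γ)`-structure differ
  by an automorphism of `𝔾`.
-/

namespace Literature.AnabelianGeometry.SemiGraphs

open CategoryTheory

universe v₁ u₁ u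

namespace SemiAnbdVocab

open SgAQuot SgAQuot.SgA

variable (R : SgA.BridgeResidual.{v₁, u₁, u})

/-- At the real vocabulary the induced arrow `H[e] → H'[e']` of Def 4.1 (iv) maps the distinguished
edge to the distinguished edge (t1's `𝔾[e]` has a single edge). [cite: MochizukiSemiAnbd2006, Def 4.1 (iv), p. 51] -/
theorem ofReal_mapE_locMapE_centerE {H H' : SgA.{v₁, u₁, u}} (f : H ⟶ H') (e : H.toSgA.graph.Edge)
    (e' : H'.toSgA.graph.Edge) (h : (SemiAnbdVocab.ofReal R).mapE f e = e') :
    (SemiAnbdVocab.ofReal R).mapE ((SemiAnbdVocab.ofReal R).locMapE f e e' h)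
        ((SemiAnbdVocab.ofReal R).centerE H e) = (SemiAnbdVocab.ofReal R).centerE H' e' :=
  rfl

/-- **Every arrow maps closed edges to closed edges** (at the real vocabulary): the branches of the
image edge are the images of the branches, and a branch abutting to a vertex maps to a branch abutting
to a vertex. [cite: MochizukiSemiAnbd2006, §1, p. 11] -/
theorem ofReal_isClosedEdge_mapE {G H : SgA.{v₁, u₁, u}} (f : G ⟶ H) (e₀ : G.toSgA.graph.Edge)
    (h : (SemiAnbdVocab.ofReal R).IsClosedEdge e₀) :
    (SemiAnbdVocab.ofReal R).IsClosedEdge ((SemiAnbdVocab.ofReal R).mapE f e₀) := by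
  intro b'
  obtain ⟨b, rfl⟩ := ((SemiAnbdVocab.ofReal R).mapBr_bijective f e₀).2 b'
  obtain ⟨v, hv⟩ := Option.isSome_iff_exists.mp (h b)
  rw [(SemiAnbdVocab.ofReal R).abut_mapBr f b v hv]
  rfl

/-- Isomorphisms preserve and reflect closed edges (at the real vocabulary).
[cite: MochizukiSemiAnbd2006, §1, p. 11] -/
theorem ofReal_isClosedEdge_mapE_iff_of_iso {G H : SgA.{v₁, u₁, u}} (γ : G ≅ H)
    (e₀ : G.toSgA.graph.Edge) :
    (SemiAnbdVocab.ofReal R).IsClosedEdge ((SemiAnbdVocab.ofReal R).mapE γ.hom e₀) ↔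
      (SemiAnbdVocab.ofReal R).IsClosedEdge e₀ := by
  refine ⟨fun h => ?_, ofReal_isClosedEdge_mapE R γ.hom e₀⟩
  have h' := ofReal_isClosedEdge_mapE R γ.inv _ h
  rwa [← (SemiAnbdVocab.ofReal R).mapE_comp, γ.hom_inv_id, (SemiAnbdVocab.ofReal R).mapE_id] at h'

/-- Isomorphisms preserve and reflect open edges (at the real vocabulary).
[cite: MochizukiSemiAnbd2006, §1, p. 12] -/
theorem ofReal_isOpenEdge_mapE_iff_of_iso {G H : SgA.{v₁, u₁, u}} (γ : G ≅ H)
    (e₀ : G.toSgA.graph.Edge) :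
    (SemiAnbdVocab.ofReal R).IsOpenEdge ((SemiAnbdVocab.ofReal R).mapE γ.hom e₀) ↔
      (SemiAnbdVocab.ofReal R).IsOpenEdge e₀ :=
  not_congr (ofReal_isClosedEdge_mapE_iff_of_iso R γ e₀)

end SemiAnbdVocab

namespace Loc

open SgAQuot SgAQuot.SgA SemiAnbdVocab

variable (R : SgA.BridgeResidual.{v₁, u₁, u})

/-- Two structure morphisms of one `(𝔾, Γ)`-structure differ by an automorphism of `𝔾` (they lie in
one `Γ`-orbit, Def 4.1 (iii)). [cite: MochizukiSemiAnbd2006, Def 4.1 (iii), p. 50] -/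
theorem GStructure.exists_iso_of_mem {Obj : Type*} [Category Obj] {𝓥 : SemiAnbdVocab Obj} {G : Obj}
    {Γ : Subgroup (Aut G)} {H : Obj} (S : GStructure 𝓥 G Γ H) {s s₁ : H ⟶ G} (hs : s ∈ S.mor)
    (hs₁ : s₁ ∈ S.mor) : ∃ γ : G ≅ G, s = s₁ ≫ γ.hom := by
  obtain ⟨t, -, hmor⟩ := S.exists_orbit
  rw [hmor] at hs hs₁
  obtain ⟨γ, -, rfl⟩ := hs
  obtain ⟨γ₁, -, rfl⟩ := hs₁
  exact ⟨γ₁.symm ≪≫ γ, by simp⟩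

/-- **Rmk 4.1.1 ("one verifies immediately"), PROVED at the real vocabulary**: a locally finite étale
arrow compatible with local `(𝔾, Γ)`-structures maps `𝔾`-open (resp. `𝔾`-closed) edges to `𝔾`-open
(resp. `𝔾`-closed) edges. [cite: MochizukiSemiAnbd2006, Rmk 4.1.1, p. 51] -/
theorem gOpenClosedPreservedStatement_ofReal (G : SgA.{v₁, u₁, u}) (Γ : Subgroup (Aut G)) :
    Literature.AnabelianGeometry.SemiGraphs.Loc.GOpenClosedPreservedStatement
      (SemiAnbdVocab.ofReal R) G Γ := by
  intro H H' L L' f _ hcompat e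
  -- a structure morphism of `H'[f e]`, and the structure morphism of `H[e]` it induces
  obtain ⟨s', hlf', hmor'⟩ := (L'.atE ((SemiAnbdVocab.ofReal R).mapE f e)).exists_orbit
  have hs' : s' ∈ (L'.atE ((SemiAnbdVocab.ofReal R).mapE f e)).mor := by
    rw [hmor']
    exact ⟨1, Γ.one_mem, (Category.comp_id s').symm⟩
  have hs : (SemiAnbdVocab.ofReal R).locMapE f e _ rfl ≫ s' ∈ (L.atE e).mor :=
    hcompat.2 e _ rfl s' hs'
  -- `f e` lies (via `s'`) over the edge of `𝔾` over which `e` lies (via the induced structure morphism)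
  have key : (SemiAnbdVocab.ofReal R).mapE s'
        ((SemiAnbdVocab.ofReal R).centerE H' ((SemiAnbdVocab.ofReal R).mapE f e)) =
      (SemiAnbdVocab.ofReal R).mapE ((SemiAnbdVocab.ofReal R).locMapE f e _ rfl ≫ s')
        ((SemiAnbdVocab.ofReal R).centerE H e) := by
    rw [(SemiAnbdVocab.ofReal R).mapE_comp, ofReal_mapE_locMapE_centerE]
  -- any other structure morphism of `H[e]` differs by an automorphism of `𝔾`
  have transfer : ∀ {s₁ : (SemiAnbdVocab.ofReal R).locE H e ⟶ G}, s₁ ∈ (L.atE e).mor →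
      ∃ γ : G ≅ G, (SemiAnbdVocab.ofReal R).mapE s'
          ((SemiAnbdVocab.ofReal R).centerE H' ((SemiAnbdVocab.ofReal R).mapE f e)) =
        (SemiAnbdVocab.ofReal R).mapE γ.hom
          ((SemiAnbdVocab.ofReal R).mapE s₁ ((SemiAnbdVocab.ofReal R).centerE H e)) := by
    intro s₁ hs₁
    obtain ⟨γ, hγ⟩ := GStructure.exists_iso_of_mem (L.atE e) hs hs₁
    refine ⟨γ, ?_⟩
    rw [key, hγ, (SemiAnbdVocab.ofReal R).mapE_comp]
  constructor
  · rintro ⟨e₀, ⟨s₁, hs₁, rfl⟩, hopen⟩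
    obtain ⟨γ, hγ⟩ := transfer hs₁
    exact ⟨_, ⟨s', hs', rfl⟩, by rw [hγ]; exact (ofReal_isOpenEdge_mapE_iff_of_iso R γ _).mpr hopen⟩
  · rintro ⟨e₀, ⟨s₁, hs₁, rfl⟩, hclosed⟩
    obtain ⟨γ, hγ⟩ := transfer hs₁
    exact ⟨_, ⟨s', hs', rfl⟩, by
      rw [hγ]; exact (ofReal_isClosedEdge_mapE_iff_of_iso R γ _).mpr hclosed⟩

end Loc

end Literature.AnabelianGeometry.SemiGraphs
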